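import Summits.QuantumFields.GaugeBoot.DiagonalRPTorusTubeCover
import HarnessLib

/-!
# Small back-expansion terms of two transverse squares are tubes (gauge-boot, L3 sequel, 8/9)

HONEST FRAMING (cell `pub-gaugeboot`, page 1 of every file): the venture produces certified bounds
on lattice expectations at stated coupling, gauge group, dimension and torus size; NOT a mass gap,
NOT a continuum limit, NOT a string tension; NOT Yang–Mills-summit-bearing (barriers
`FixedCouplingUltralocality`, `PerturbativeInvisibility`). This module is bookkeeping for a
structural NEGATIVE result (`DiagonalRPTorusInnerHalfNegativeHighDim`); it discharges nothing by
itself.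

## Content (setting of `DiagonalRPTorusTubeCover`: `L = 2c`, `c ≥ 2`, `i < j < k < l`, squares
`v = sq k l x` on the layer `c - 1` and `u = sq k l z` on the layer `-(c-1)`, `Q ⊆ restPlaqs`,
`|Q| ≤ 8`, `T_Q(u,v) ≠ 0`, centre element `ρ z₀ = ω • 1`, `ω ≠ 1`)

Starting from the eight covering faces of `cover_structure`:

* `pairT_eq_zero_of_lonely_vface` / `_uface` — a covering face with a link read by no other
  factor kills the term (lonely-link reduction, then the uncovered edge);
* **uniform types** (`vtypes_uniform`, `utypes_uniform`): the four faces over `v` are all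
  `+e_i` faces or all `-e_j` faces (a mixed corner `w` has the lonely link `(w, i)`), and likewise
  under `u` (lonely link `(w - e_i, i)`);
* **matching** (`top_eq_bot`): the layer-`c` square of the `v`-faces is the layer-`c` square of the
  `u`-faces (otherwise a layer-`c` edge is lonely);
* ★ **`tube_shape`**: hence `Q` is one of the four TUBES from `v` to `u` and
  `z ∈ {x + 2e_i, x + e_i - e_j, x - 2e_j}`; in particular (`pairT_eq_zero_of_not_tube_offset`)
  every term with `|Q| ≤ 8` vanishes when `z` is none of these, and for `z = x + 2e_i`
  (`eq_tubeII_of_pairT_ne_zero`) resp. `z = x - 2e_j` (`eq_tubeJJ_of_pairT_ne_zero`) the only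
  surviving `Q` is the straight tube.

Elementary bookkeeping; no named fact.
-/

open MeasureTheory Finset Function

namespace Summit.QuantumFields.GaugeBoot

open Literature.MathematicalPhysics.QuantumFieldTheory

noncomputable section

namespace DiagRPTube

variable {d L : ℕ}

/-! ## Corners and small geometric facts -/

section Corners

variable {k l : Fin d} (hkl : k < l)

include hkl in
/-- **Adjacent edges and their corner**: for each edge `a` of the square at `x`, the edges `a` and
`a + 1` share a corner `w` lying on no other edge (`L ≥ 3`). -/
theorem corner_adj (hL : 3 ≤ L) (x : Site d L) (a : Fin 4) :
    ∃ w : Site d L, (w = eStart k l x a ∨ w = eEnd k l x a) ∧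
      (w = eStart k l x (a + 1) ∨ w = eEnd k l x (a + 1)) ∧
      ∀ b : Fin 4, b ≠ a → b ≠ a + 1 → w ≠ eStart k l x b ∧ w ≠ eEnd k l x b := by
  obtain ⟨h01, h02, h03, h12, h13, h23⟩ := corner_nes hkl hL x
  have hE2 : eEnd k l x 2 = eEnd k l x 1 := by simp [eEnd, eStart, eDir, WilsonRP.shift_comm]
  have hE0 : eEnd k l x 0 = eStart k l x 1 := rfl
  have hE3 : eEnd k l x 3 = eStart k l x 2 := rfl
  have hS3 : eStart k l x 3 = eStart k l x 0 := rfl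
  have hb4 : ∀ b : Fin 4, b = 0 ∨ b = 1 ∨ b = 2 ∨ b = 3 := by intro b; fin_cases b <;> simp
  have ha4 := hb4 a
  rcases ha4 with rfl | rfl | rfl | rfl
  · refine ⟨eStart k l x 1, Or.inr hE0.symm, Or.inl rfl, fun b hb hb' => ?_⟩
    rcases hb4 b with rfl | rfl | rfl | rfl
    · exact absurd rfl hb
    · exact absurd (by decide) hb'
    · exact ⟨h12, by rw [hE2]; exact h13⟩
    · exact ⟨by rw [hS3]; exact h01.symm, by rw [hE3]; exact h12⟩
  · refine ⟨eEnd k l x 1, Or.inr rfl, Or.inr (by rw [show (1 : Fin 4) + 1 = 2 from rfl, hE2]),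
      fun b hb hb' => ?_⟩
    rcases hb4 b with rfl | rfl | rfl | rfl
    · exact ⟨h03.symm, by rw [hE0]; exact h13.symm⟩
    · exact absurd rfl hb
    · exact absurd (by decide) hb'
    · exact ⟨by rw [hS3]; exact h03.symm, by rw [hE3]; exact h23.symm⟩
  · refine ⟨eStart k l x 2, Or.inl rfl, Or.inr (by rw [show (2 : Fin 4) + 1 = 3 from rfl, hE3]),
      fun b hb hb' => ?_⟩
    rcases hb4 b with rfl | rfl | rfl | rfl
    · exact ⟨h02.symm, by rw [hE0]; exact h12.symm⟩
    · exact ⟨h12.symm, h23⟩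
    · exact absurd rfl hb
    · exact absurd (by decide) hb'
  · refine ⟨eStart k l x 0, Or.inl hS3.symm, Or.inl (by rw [show (3 : Fin 4) + 1 = 0 from rfl]),
      fun b hb hb' => ?_⟩
    rcases hb4 b with rfl | rfl | rfl | rfl
    · exact absurd (by decide) hb'
    · exact ⟨h01, h03⟩
    · exact ⟨h02, by rw [hE2]; exact h03⟩
    · exact absurd rfl hb

/-- Edges of a transverse square have transverse direction. -/
theorem dir_of_hasLink_sq {y s : Site d L} {n : Fin d} (h : HasLink (sq k l hkl y) (s, n)) :
    n = k ∨ n = l := by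
  obtain ⟨a, ha⟩ := h
  rw [link_sq] at ha
  have h2 : eDir k l a = n := congrArg Prod.snd ha
  rw [← h2]
  exact eDir_eq_or a

/-- End points of down-shifted squares. -/
theorem eEnd_dn (x : Site d L) (m : Fin d) (a : Fin 4) :
    eEnd k l (dn x m) a = dn (eEnd k l x a) m := by
  simp only [eEnd, eStart_dn, dn_shift_comm]

/-- `dn` is injective. -/
theorem dn_injective (m : Fin d) : Function.Injective fun x : Site d L => dn x m :=
  fun x y h => by simpa using congrArg (fun w : Site d L => w.shift m) h

end Corners

/-! ## The shape of a non-zero small term -/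

section Shape

variable [NeZero L] {N : ℕ} {G : Type*} [Group G] [TopologicalSpace G]
  [IsTopologicalGroup G] [CompactSpace G] [MeasurableSpace G] [BorelSpace G]
  [SecondCountableTopology G] {ρ : G →* Matrix (Fin N) (Fin N) ℂ} {β : ℝ}
  {i j k l : Fin d} (hij : i < j) (hjk : j < k) (hkl : k < l) {c : ℕ} (hc : 2 ≤ c)
  (hL : L = 2 * c) (hρ : Continuous ρ) {z₀ : G} {ω : ℂ}
  (hz₀ : ρ z₀ = ω • (1 : Matrix (Fin N) (Fin N) ℂ)) (hω : ω ≠ 1)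
  {x z : Site d L} (hx : lay i j x = ((c - 1 : ℕ) : ZMod L))
  (hz : lay i j z = -((c - 1 : ℕ) : ZMod L))
  {Q : Finset (Plaquette d L)} {qv qu : Fin 4 → Plaquette d L}
  (hv : ∀ a, qv a ∈ Q ∧ HasLink (qv a) (link (sq k l hkl x) a) ∧
    (qv a = ring (hij.trans hjk) (hij.trans (hjk.trans hkl)) x a ∨
      qv a = ring hjk (hjk.trans hkl) (dn x j) a))
  (hu : ∀ a, qu a ∈ Q ∧ HasLink (qu a) (link (sq k l hkl z) a) ∧
    (qu a = ring (hij.trans hjk) (hij.trans (hjk.trans hkl)) (dn z i) a ∨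
      qu a = ring hjk (hjk.trans hkl) z a))
  (hex : ∀ q ∈ Q, (∃ a, q = qv a) ∨ (∃ a, q = qu a))

include hij hjk hkl hc hL hρ hz₀ hω hx hz hv hu hex

/-- **A lonely link in a low covering face kills the term.** -/
theorem pairT_eq_zero_of_lonely_vface (a : Fin 4) {ℓ : Edge d L} (h1 : HasLink (qv a) ℓ)
    (h2 : ¬ HasLink (sq k l hkl x) ℓ) (h3 : ¬ HasLink (sq k l hkl z) ℓ)
    (h4 : ∀ b, b ≠ a → ¬ HasLink (qv b) ℓ) (h5 : ∀ b, ¬ HasLink (qu b) ℓ) :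
    pairT ρ β Q (sq k l hkl z) (sq k l hkl x) = 0 := by
  have hL3 : 3 ≤ L := by omega
  have hlone : ∀ q' ∈ Q, q' ≠ qv a → ¬ HasLink q' ℓ := by
    intro q' hq' hne
    rcases hex q' hq' with ⟨b, rfl⟩ | ⟨b, rfl⟩
    · exact h4 b fun hb => hne (by rw [hb])
    · exact h5 b
  obtain ⟨κ, hκ⟩ := pairT_eq_mul_pairT_erase ρ β hρ hL3 (hv a).1 h1 hlone h3 h2
  rw [hκ]
  suffices h0 : pairT ρ β (Q.erase (qv a)) (sq k l hkl z) (sq k l hkl x) = 0 by rw [h0, mul_zero]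
  refine pairT_eq_zero_of_uncovered_right ρ β hρ hL3 hz₀ hω ⟨a, rfl⟩
    (not_hasLink_high_low hij hjk hkl hc hL hx hz a) fun q' hq' => ?_
  obtain ⟨hne, hq'Q⟩ := mem_erase.1 hq'
  rcases hex q' hq'Q with ⟨b, rfl⟩ | ⟨b, rfl⟩
  · exact fun h => hne (by rw [eq_of_hasLink_vface hij hjk hkl hL3 (hv b).2.2 h])
  · exact not_hasLink_uface_low hij hjk hkl hc hL hx hz (hu b).2.2 a

/-- **A lonely link in a high covering face kills the term.** -/
theorem pairT_eq_zero_of_lonely_uface (a : Fin 4) {ℓ : Edge d L} (h1 : HasLink (qu a) ℓ)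
    (h2 : ¬ HasLink (sq k l hkl x) ℓ) (h3 : ¬ HasLink (sq k l hkl z) ℓ)
    (h4 : ∀ b, b ≠ a → ¬ HasLink (qu b) ℓ) (h5 : ∀ b, ¬ HasLink (qv b) ℓ) :
    pairT ρ β Q (sq k l hkl z) (sq k l hkl x) = 0 := by
  have hL3 : 3 ≤ L := by omega
  have hlone : ∀ q' ∈ Q, q' ≠ qu a → ¬ HasLink q' ℓ := by
    intro q' hq' hne
    rcases hex q' hq' with ⟨b, rfl⟩ | ⟨b, rfl⟩
    · exact h5 b
    · exact h4 b fun hb => hne (by rw [hb])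
  obtain ⟨κ, hκ⟩ := pairT_eq_mul_pairT_erase ρ β hρ hL3 (hu a).1 h1 hlone h3 h2
  rw [hκ]
  suffices h0 : pairT ρ β (Q.erase (qu a)) (sq k l hkl z) (sq k l hkl x) = 0 by rw [h0, mul_zero]
  refine pairT_eq_zero_of_uncovered_left ρ β hρ hL3 hz₀ hω ⟨a, rfl⟩
    (not_hasLink_low_high hij hjk hkl hc hL hx hz a) fun q' hq' => ?_
  obtain ⟨hne, hq'Q⟩ := mem_erase.1 hq'
  rcases hex q' hq'Q with ⟨b, rfl⟩ | ⟨b, rfl⟩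
  · exact not_hasLink_vface_high hij hjk hkl hc hL hx hz (hv b).2.2 a
  · exact fun h => hne (by rw [eq_of_hasLink_uface hij hjk hkl hL3 (hu b).2.2 h])

/-- **Mixed corners over `v` kill the term**: adjacent edges `a`, `a+1` with faces of different
types. -/
theorem pairT_eq_zero_of_vmixed (hT : pairT ρ β Q (sq k l hkl z) (sq k l hkl x) ≠ 0) (a a' : Fin 4)
    (hadj : a' = a + 1 ∨ a = a' + 1)
    (ha : qv a = ring (hij.trans hjk) (hij.trans (hjk.trans hkl)) x a)
    (ha' : qv a' = ring hjk (hjk.trans hkl) (dn x j) a') : False := by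
  have hL3 : 3 ≤ L := by omega
  have hij' : i ≠ j := ne_of_lt hij
  have hik' : i ≠ k := ne_of_lt (hij.trans hjk)
  have hil' : i ≠ l := ne_of_lt (hij.trans (hjk.trans hkl))
  have hki : k ≠ i := hik'.symm
  have hkj : k ≠ j := (ne_of_lt hjk).symm
  have hli : l ≠ i := hil'.symm
  have hlj : l ≠ j := (ne_of_lt (hjk.trans hkl)).symm
  -- the shared corner `w` of `a` and `a'`
  obtain ⟨w, hwa, hwa', hother⟩ : ∃ w : Site d L, (w = eStart k l x a ∨ w = eEnd k l x a) ∧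
      (w = eStart k l x a' ∨ w = eEnd k l x a') ∧
      ∀ b : Fin 4, b ≠ a → b ≠ a' → w ≠ eStart k l x b ∧ w ≠ eEnd k l x b := by
    rcases hadj with rfl | rfl
    · exact corner_adj hkl hL3 x a
    · obtain ⟨w, h1, h2, h3⟩ := corner_adj hkl hL3 x a'
      exact ⟨w, h2, h1, fun b hb hb' => h3 b hb' hb⟩
  have hlayw : lay i j w = ((c - 1 : ℕ) : ZMod L) := by
    rcases hwa with rfl | rfl
    · rw [lay_eStart hki hkj hli hlj, hx]
    · rw [lay_eEnd hij hjk hkl, hx]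
  refine hT (pairT_eq_zero_of_lonely_vface hij hjk hkl hc hL hρ hz₀ hω hx hz hv hu hex a
    (ℓ := (w, i)) ?_ ?_ ?_ ?_ ?_)
  · rw [ha]
    rcases hwa with rfl | rfl
    · exact hasLink_ring_start _ _ hkl x a
    · exact hasLink_ring_end _ _ hkl x a
  · intro h; rcases dir_of_hasLink_sq hkl h with h | h <;> [exact hik' h; exact hil' h]
  · intro h; rcases dir_of_hasLink_sq hkl h with h | h <;> [exact hik' h; exact hil' h]
  · intro b hb h
    rcases (hv b).2.2 with hb' | hb'
    · rw [hb'] at h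
      by_cases hba' : b = a'
      · rw [hba', ha'] at hb'
        -- `ring i … = ring j …` is impossible: first directions differ
        exact hij' (congrArg (fun q : Plaquette d L => q.2.1.1) hb'.symm)
      · obtain ⟨hs, he⟩ := hother b hb hba'
        rcases hasLink_ring_longitudinal _ _ hkl h with h' | h'
        · exact hs h'
        · exact he h'
    · rw [hb'] at h
      exact not_hasLink_ring_of_dir _ _ hkl hij' hik' hil' h
  · intro b h
    rcases (hu b).2.2 with hb' | hb'
    · rw [hb'] at h
      rcases hasLink_ring_longitudinal _ _ hkl h with h' | h'
      · have := congrArg (lay i j) h'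
        rw [hlayw, lay_eStart hki hkj hli hlj, lay_dn_i hij', hz, neg_cast_pred_sub_one hc hL] at this
        exact cast_pred_ne_c hc hL this
      · have := congrArg (lay i j) h'
        rw [hlayw, lay_eEnd hij hjk hkl, lay_dn_i hij', hz, neg_cast_pred_sub_one hc hL] at this
        exact cast_pred_ne_c hc hL this
    · rw [hb'] at h
      exact not_hasLink_ring_of_dir _ _ hkl hij' hik' hil' h

/-- **Mixed corners under `u` kill the term.** -/
theorem pairT_eq_zero_of_umixed (hT : pairT ρ β Q (sq k l hkl z) (sq k l hkl x) ≠ 0) (a a' : Fin 4)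
    (hadj : a' = a + 1 ∨ a = a' + 1)
    (ha : qu a = ring (hij.trans hjk) (hij.trans (hjk.trans hkl)) (dn z i) a)
    (ha' : qu a' = ring hjk (hjk.trans hkl) z a') : False := by
  have hL3 : 3 ≤ L := by omega
  have hij' : i ≠ j := ne_of_lt hij
  have hik' : i ≠ k := ne_of_lt (hij.trans hjk)
  have hil' : i ≠ l := ne_of_lt (hij.trans (hjk.trans hkl))
  have hki : k ≠ i := hik'.symm
  have hkj : k ≠ j := (ne_of_lt hjk).symm
  have hli : l ≠ i := hil'.symm
  have hlj : l ≠ j := (ne_of_lt (hjk.trans hkl)).symm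
  obtain ⟨w, hwa, hwa', hother⟩ : ∃ w : Site d L, (w = eStart k l z a ∨ w = eEnd k l z a) ∧
      (w = eStart k l z a' ∨ w = eEnd k l z a') ∧
      ∀ b : Fin 4, b ≠ a → b ≠ a' → w ≠ eStart k l z b ∧ w ≠ eEnd k l z b := by
    rcases hadj with rfl | rfl
    · exact corner_adj hkl hL3 z a
    · obtain ⟨w, h1, h2, h3⟩ := corner_adj hkl hL3 z a'
      exact ⟨w, h2, h1, fun b hb hb' => h3 b hb' hb⟩
  have hlayw : lay i j (dn w i) = ((c : ℕ) : ZMod L) := by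
    rw [lay_dn_i hij']
    rcases hwa with rfl | rfl
    · rw [lay_eStart hki hkj hli hlj, hz, neg_cast_pred_sub_one hc hL]
    · rw [lay_eEnd hij hjk hkl, hz, neg_cast_pred_sub_one hc hL]
  refine hT (pairT_eq_zero_of_lonely_uface hij hjk hkl hc hL hρ hz₀ hω hx hz hv hu hex a
    (ℓ := (dn w i, i)) ?_ ?_ ?_ ?_ ?_)
  · rw [ha]
    rcases hwa with rfl | rfl
    · rw [← eStart_dn]; exact hasLink_ring_start _ _ hkl _ a
    · rw [← eEnd_dn]; exact hasLink_ring_end _ _ hkl _ a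
  · intro h; rcases dir_of_hasLink_sq hkl h with h | h <;> [exact hik' h; exact hil' h]
  · intro h; rcases dir_of_hasLink_sq hkl h with h | h <;> [exact hik' h; exact hil' h]
  · intro b hb h
    rcases (hu b).2.2 with hb' | hb'
    · rw [hb'] at h
      by_cases hba' : b = a'
      · rw [hba', ha'] at hb'
        exact hij' (congrArg (fun q : Plaquette d L => q.2.1.1) hb'.symm)
      · obtain ⟨hs, he⟩ := hother b hb hba'
        rcases hasLink_ring_longitudinal _ _ hkl h with h' | h'
        · rw [eStart_dn] at h'; exact hs (dn_injective i h')
        · rw [eEnd_dn] at h'; exact he (dn_injective i h')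
    · rw [hb'] at h
      exact not_hasLink_ring_of_dir _ _ hkl hij' hik' hil' h
  · intro b h
    rcases (hv b).2.2 with hb' | hb'
    · rw [hb'] at h
      rcases hasLink_ring_longitudinal _ _ hkl h with h' | h'
      · have := congrArg (lay i j) h'
        rw [hlayw, lay_eStart hki hkj hli hlj, hx] at this
        exact cast_pred_ne_c hc hL this.symm
      · have := congrArg (lay i j) h'
        rw [hlayw, lay_eEnd hij hjk hkl, hx] at this
        exact cast_pred_ne_c hc hL this.symm
    · rw [hb'] at h
      exact not_hasLink_ring_of_dir _ _ hkl hij' hik' hil' h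

/-- **Uniform types over `v`.** -/
theorem vtypes_uniform (hT : pairT ρ β Q (sq k l hkl z) (sq k l hkl x) ≠ 0) :
    (∀ a, qv a = ring (hij.trans hjk) (hij.trans (hjk.trans hkl)) x a) ∨
      (∀ a, qv a = ring hjk (hjk.trans hkl) (dn x j) a) := by
  have M := pairT_eq_zero_of_vmixed hij hjk hkl hc hL hρ hz₀ hω hx hz hv hu hex hT
  -- propagate the type of edge `0` around the square
  have step : ∀ a : Fin 4, (qv a = ring (hij.trans hjk) (hij.trans (hjk.trans hkl)) x a ↔
      qv (a + 1) = ring (hij.trans hjk) (hij.trans (hjk.trans hkl)) x (a + 1)) := by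
    intro a
    constructor
    · intro ha
      rcases (hv (a + 1)).2.2 with h | h
      · exact h
      · exact (M a (a + 1) (Or.inl rfl) ha h).elim
    · intro ha
      rcases (hv a).2.2 with h | h
      · exact h
      · exact (M (a + 1) a (Or.inr rfl) ha h).elim
  rcases (hv 0).2.2 with h0 | h0
  · left
    have h1 := (step 0).1 h0
    have h2 := (step 1).1 h1
    have h3 := (step 2).1 h2
    intro a; fin_cases a <;> assumption
  · right
    have hne : ∀ a, qv a ≠ ring (hij.trans hjk) (hij.trans (hjk.trans hkl)) x a →
        qv a = ring hjk (hjk.trans hkl) (dn x j) a := fun a hna => (hv a).2.2.resolve_left hna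
    have hij' : i ≠ j := ne_of_lt hij
    have hnot : ∀ a, qv a = ring hjk (hjk.trans hkl) (dn x j) a →
        qv a ≠ ring (hij.trans hjk) (hij.trans (hjk.trans hkl)) x a := fun a ha h =>
      hij' (congrArg (fun q : Plaquette d L => q.2.1.1) (h.symm.trans ha))
    have h3 : qv 3 = _ := hne 3 fun h => hnot 0 h0 ((step 3).1 h)
    have h2 : qv 2 = _ := hne 2 fun h => hnot 3 h3 ((step 2).1 h)
    have h1 : qv 1 = _ := hne 1 fun h => hnot 2 h2 ((step 1).1 h)
    intro a; fin_cases a <;> assumption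

/-- **Uniform types under `u`.** -/
theorem utypes_uniform (hT : pairT ρ β Q (sq k l hkl z) (sq k l hkl x) ≠ 0) :
    (∀ a, qu a = ring (hij.trans hjk) (hij.trans (hjk.trans hkl)) (dn z i) a) ∨
      (∀ a, qu a = ring hjk (hjk.trans hkl) z a) := by
  have M := pairT_eq_zero_of_umixed hij hjk hkl hc hL hρ hz₀ hω hx hz hv hu hex hT
  have step : ∀ a : Fin 4, (qu a = ring (hij.trans hjk) (hij.trans (hjk.trans hkl)) (dn z i) a ↔
      qu (a + 1) = ring (hij.trans hjk) (hij.trans (hjk.trans hkl)) (dn z i) (a + 1)) := by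
    intro a
    constructor
    · intro ha
      rcases (hu (a + 1)).2.2 with h | h
      · exact h
      · exact (M a (a + 1) (Or.inl rfl) ha h).elim
    · intro ha
      rcases (hu a).2.2 with h | h
      · exact h
      · exact (M (a + 1) a (Or.inr rfl) ha h).elim
  rcases (hu 0).2.2 with h0 | h0
  · left
    have h1 := (step 0).1 h0
    have h2 := (step 1).1 h1
    have h3 := (step 2).1 h2
    intro a; fin_cases a <;> assumption
  · right
    have hne : ∀ a, qu a ≠ ring (hij.trans hjk) (hij.trans (hjk.trans hkl)) (dn z i) a →
        qu a = ring hjk (hjk.trans hkl) z a := fun a hna => (hu a).2.2.resolve_left hna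
    have hij' : i ≠ j := ne_of_lt hij
    have hnot : ∀ a, qu a = ring hjk (hjk.trans hkl) z a →
        qu a ≠ ring (hij.trans hjk) (hij.trans (hjk.trans hkl)) (dn z i) a := fun a ha h =>
      hij' (congrArg (fun q : Plaquette d L => q.2.1.1) (h.symm.trans ha))
    have h3 : qu 3 = _ := hne 3 fun h => hnot 0 h0 ((step 3).1 h)
    have h2 : qu 2 = _ := hne 2 fun h => hnot 3 h3 ((step 2).1 h)
    have h1 : qu 1 = _ := hne 1 fun h => hnot 2 h2 ((step 1).1 h)
    intro a; fin_cases a <;> assumption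

end Shape

end DiagRPTube

end

end Summit.QuantumFields.GaugeBoot
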